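import Mathlib
import Summits.NavierStokesRegularity.NavierStokesRegularity.Theorems.LerayQuarterDissipationFiniteDissipationLiouvilleVorticityAmplitudeJoint
import Summits.NavierStokesRegularity.NavierStokesRegularity.Theorems.LerayQuarterDissipationFiniteDissipationLiouvilleVorticityAmplitudeWindows
import HarnessLib

/-!
# Crux `FiniteDissipationLiouville` (stmt-NavierStokesRegularity-22144): the JOINT velocity /
# vorticity-amplitude floor recurs in EVERY long backward log-window

Theorems file of route `LerayQuarterDissipation` (lead prover g15; `--supports` the crux; the window
form of `…VorticityAmplitudeJoint.vorticity_exceeds_joint_of_singular`, on the pattern of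
`…VorticityAmplitudeWindows`). Navier–Stokes regularity is NOT proved by anything here; no summit is.

`𝒟_{C,K}`: Type-I ancient mild fields (KNSS gauge, constant `C`) with the quarter-rate law (constant
`K`). `…Joint`: a member with `(−t)‖curl u‖ ≤ C_ω` everywhere and `λ²C² + (1−λ)(4/√3)C_ω < 1` for some
`λ ∈ (0,1]` vanishes. This file localises the hypothesis to log-time windows of unbounded length:

* `notSingular_of_joint_windows` — if `λ²C² + (1−λ)(4/√3)C_ω < 1` (`0 < λ ≤ 1`) and for every `Λ > 1`
  some backward window `[Λ²τ, τ/Λ²]` has `(−t)‖curl u(t,x)‖ ≤ C_ω` for all its `t` and all `x`, then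
  `u` is bounded at the apex (the KNSS limit along the window scales is a member of `𝒟_{C,K}` with the
  bound for ALL `t`, singular by persistence — excluded by `not_singular_of_joint`);
* `vorticity_exceeds_joint_windows_of_singular` — **a SINGULAR member has, for every such `(λ, C_ω)`, a
  window length `Λ` such that every backward window `[Λ²τ, τ/Λ²]` contains a point with
  `C_ω < (−t)‖curl u(t,x)‖`**; in particular with `C` close to `1` the vorticity amplitude
  `(√3/2)C²(1 − √(1 − C⁻²)) − δ` is exceeded in every long window.

HONEST FRAMING: portrait clause of the hypothetical singular profile; explicit thresholds, window
length by compactness; nothing removed from the DSS wall; nothing here bears on Navier–Stokes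
regularity or blow-up.

References: Koch–Nadirashvili–Seregin–Šverák, Acta Math. 203 (2009) §4; folklore.
-/

noncomputable section

set_option linter.dupNamespace false

namespace Summit.NavierStokesRegularity.NavierStokesRegularity.Theorems.FiniteDissipationLiouville.VorticityAmplitude

open MeasureTheory Set Filter Topology Metric Function Real
open scoped ENNReal
open Literature.Analysis Literature.Analysis.FluidPDE
open Summit.NavierStokesRegularity.NavierStokesRegularity.Theorems
open Summit.NavierStokesRegularity.NavierStokesRegularity.Theorems.FiniteDissipationLiouville

/-- **The joint bound on long windows forces apex regularity.** Let `u ∈ 𝒟_{C,K}`, `0 < λ ≤ 1` and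
`C_ω` with `λ²C² + (1−λ)(4/√3)C_ω < 1`. If for every `Λ > 1` there is `τ < 0` with
`(−t)‖curl u(t,x)‖ ≤ C_ω` for all `t ∈ [Λ²τ, τ/Λ²]` and all `x`, then `u` is bounded on some backward
cylinder at the origin. [cite: KochNadirashviliSereginSverak2009, §4 (arXiv:0709.3599 p. 8)] -/
theorem notSingular_of_joint_windows {C K : ℝ}
    {u : ℝ → EuclideanSpace ℝ (Fin 3) → EuclideanSpace ℝ (Fin 3)} (hu : IsTypeIAncientMild C u)
    (hlaw : ∀ s : ℝ, s < 0 → ∫⁻ x, ‖fderiv ℝ (u s) x‖ₑ ^ 2 ≤ ENNReal.ofReal (K / Real.sqrt (-s)))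
    {lam : ℝ} (hlam0 : 0 < lam) (hlam1 : lam ≤ 1) {Cω : ℝ}
    (hjoint : lam ^ 2 * C ^ 2 + (1 - lam) * (4 * Cω * Real.sqrt 3 / 3) < 1)
    (hwin : ∀ Λ : ℝ, 1 < Λ → ∃ τ : ℝ, τ < 0 ∧ ∀ t ∈ Set.Icc (Λ ^ 2 * τ) (τ / Λ ^ 2), ∀ x,
      (-t) * ‖curl (u t) x‖ ≤ Cω) :
    ¬ (∀ r > 0, ∀ M : ℝ, ∃ t ∈ Set.Ioo (-(r ^ 2)) (0 : ℝ),
        ∃ x ∈ Metric.ball (0 : EuclideanSpace ℝ (Fin 3)) r, M < ‖u t x‖) := by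
  intro hsing
  set θ : ℝ := Cω with hθ
  -- windows at `Λ_k = k + 2`, scales `l_k = √(-τ_k)`
  have hΛ : ∀ k : ℕ, (1 : ℝ) < (k : ℝ) + 2 := fun k => by
    have : (0 : ℝ) ≤ k := Nat.cast_nonneg k
    linarith
  choose τ hτ hτwin using fun k : ℕ => hwin ((k : ℝ) + 2) (hΛ k)
  set l : ℕ → ℝ := fun k => Real.sqrt (-τ k) with hl_def
  have hl : ∀ k, 0 < l k := fun k => Real.sqrt_pos.2 (neg_pos.2 (hτ k))
  have hl2 : ∀ k, l k ^ 2 = -τ k := fun k => Real.sq_sqrt (neg_pos.2 (hτ k)).le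
  -- the rescaled members
  set v : ℕ → ℝ → EuclideanSpace ℝ (Fin 3) → EuclideanSpace ℝ (Fin 3) := fun k => nsRescale (l k) u
    with hvdef
  have hv : ∀ k, IsTypeIAncientMild C (v k) := fun k => hu.nsRescale (hl k)
  have hvlaw : ∀ k, ∀ s : ℝ, s < 0 →
      ∫⁻ x, ‖fderiv ℝ (v k s) x‖ₑ ^ 2 ≤ ENNReal.ofReal (K / Real.sqrt (-s)) := fun k =>
    RecurrentReductionD.dissipationLaw_nsRescale hlaw (hl k)
  have hvsing : ∀ k, ∀ r > 0, ∀ M : ℝ, ∃ t ∈ Ioo (-(r ^ 2)) (0 : ℝ),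
      ∃ x ∈ ball (0 : EuclideanSpace ℝ (Fin 3)) r, M < ‖v k t x‖ := fun k =>
    RecurrentReductionD.singularAtOrigin_nsRescale hsing (hl k)
  -- the rescaled vorticity bound, eventually for every fixed `s < 0`
  have hev : ∀ s : ℝ, s < 0 → ∀ᶠ k : ℕ in atTop, ∀ y, (-s) * ‖curl (v k s) y‖ ≤ θ := by
    intro s hs
    have hT : Tendsto (fun k : ℕ => ((k : ℝ) + 2) ^ 2) atTop atTop :=
      (tendsto_pow_atTop two_ne_zero).comp
        (tendsto_atTop_add_const_right atTop (2 : ℝ) tendsto_natCast_atTop_atTop)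
    filter_upwards [hT.eventually_ge_atTop (-s), hT.eventually_ge_atTop (-s⁻¹)] with k h1 h2 y
    have hτ' : 0 < -τ k := neg_pos.2 (hτ k)
    have hs' : 0 < -s := neg_pos.2 hs
    -- the rescaled time `l_k² s` lies in the `k`-th window
    have hmem : l k ^ 2 * s ∈ Set.Icc (((k : ℝ) + 2) ^ 2 * τ k) (τ k / ((k : ℝ) + 2) ^ 2) := by
      rw [hl2 k]
      refine ⟨by nlinarith, ?_⟩
      have hΛ2 : (0 : ℝ) < ((k : ℝ) + 2) ^ 2 := by positivity
      rw [le_div_iff₀ hΛ2]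
      have h3 : 1 ≤ (-s) * ((k : ℝ) + 2) ^ 2 := by
        have := mul_le_mul_of_nonneg_left h2 hs'.le
        rwa [show (-s) * (-s⁻¹) = 1 by rw [neg_mul_neg, mul_inv_cancel₀ hs.ne]] at this
      nlinarith
    have key := hτwin k (l k ^ 2 * s) hmem (l k • y)
    -- `(-s) ‖curl u_l(s)(y)‖ = (-(l² s)) ‖curl u(l² s)(l y)‖`
    rw [hvdef]
    dsimp only
    rw [QuietVorticity.curl_nsRescale, norm_smul, Real.norm_of_nonneg (mul_self_nonneg _)]
    calc (-s) * (l k * l k * ‖curl (u (l k ^ 2 * s)) (l k • y)‖)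
        = (-(l k ^ 2 * s)) * ‖curl (u (l k ^ 2 * s)) (l k • y)‖ := by ring
      _ ≤ θ := key
  -- KNSS limit along the scales: a member of `𝒟_{C,K}`, singular, with the bound for ALL `t`
  obtain ⟨ψ, hψ, W, hW, hunif, hpt, hgrad⟩ := Compactness.seqLimit hv
  have hψt : Tendsto ψ atTop atTop := hψ.tendsto_atTop
  have hWlaw : ∀ s : ℝ, s < 0 →
      ∫⁻ x, ‖fderiv ℝ (W s) x‖ₑ ^ 2 ≤ ENNReal.ofReal (K / Real.sqrt (-s)) :=
    Compactness.law_of_seqLimit (Kk := fun _ => K) (Kinf := K) hψt hvlaw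
      (fun ε hε => Eventually.of_forall fun k => by linarith) hgrad
  have hWsing := Compactness.persistent_singularity_seq (w := fun j => v (ψ j))
    (fun j => hv _) (fun j => hvlaw _) (fun j => hvsing _) hW hunif
  have hWθ : ∀ s : ℝ, s < 0 → ∀ y, (-s) * ‖curl (W s) y‖ ≤ θ := by
    intro s hs y
    have h1 : Tendsto (fun j => (-s) * ‖curl (v (ψ j) s) y‖) atTop (𝓝 ((-s) * ‖curl (W s) y‖)) := by
      have hc : Tendsto (fun j => curl (v (ψ j) s) y) atTop (𝓝 (curl (W s) y)) := by
        simp only [curl_eq_curlCLM]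
        exact (curlCLM.continuous.tendsto _).comp (hgrad s hs y)
      exact tendsto_const_nhds.mul hc.norm
    exact le_of_tendsto h1 ((hψt.eventually (hev s hs)).mono fun j hj => hj y)
  exact not_singular_of_joint hW hWlaw hWθ hlam0 hlam1 hjoint hWsing

/-- **A singular finite-dissipation profile violates every joint bound in every long log-window.** If
`u ∈ 𝒟_{C,K}` is singular at the apex, then for every `0 < λ ≤ 1` and `C_ω` with
`λ²C² + (1−λ)(4/√3)C_ω < 1` there is `Λ > 1` such that every backward window `[Λ²τ, τ/Λ²]` (`τ < 0`)
contains `(t, x)` with `C_ω < (−t)‖curl u(t,x)‖`. [cite: KochNadirashviliSereginSverak2009, §4 (arXiv:0709.3599 p. 8)] -/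
theorem vorticity_exceeds_joint_windows_of_singular {C K : ℝ}
    {u : ℝ → EuclideanSpace ℝ (Fin 3) → EuclideanSpace ℝ (Fin 3)} (hu : IsTypeIAncientMild C u)
    (hlaw : ∀ s : ℝ, s < 0 → ∫⁻ x, ‖fderiv ℝ (u s) x‖ₑ ^ 2 ≤ ENNReal.ofReal (K / Real.sqrt (-s)))
    (hsing : ∀ r > 0, ∀ M : ℝ, ∃ t ∈ Set.Ioo (-(r ^ 2)) (0 : ℝ),
      ∃ x ∈ Metric.ball (0 : EuclideanSpace ℝ (Fin 3)) r, M < ‖u t x‖)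
    {lam : ℝ} (hlam0 : 0 < lam) (hlam1 : lam ≤ 1) {Cω : ℝ}
    (hjoint : lam ^ 2 * C ^ 2 + (1 - lam) * (4 * Cω * Real.sqrt 3 / 3) < 1) :
    ∃ Λ : ℝ, 1 < Λ ∧ ∀ τ : ℝ, τ < 0 →
      ∃ t ∈ Set.Icc (Λ ^ 2 * τ) (τ / Λ ^ 2), ∃ x, Cω < (-t) * ‖curl (u t) x‖ := by
  by_contra hcon
  push Not at hcon
  exact notSingular_of_joint_windows hu hlaw hlam0 hlam1 hjoint hcon hsing

end Summit.NavierStokesRegularity.NavierStokesRegularity.Theorems.FiniteDissipationLiouville.VorticityAmplitude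

end
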